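import Summits.BirchSwinnertonDyer.Rank1Residual.Additive.BudgetFromTamagawaWitnesses
import Summits.BirchSwinnertonDyer.Rank1Residual.Additive.BudgetFromSelmerInftyClasses
import Summits.BirchSwinnertonDyer.Rank1Residual.Additive.LayerNoPTorsion
import Summits.BirchSwinnertonDyer.Rank1Residual.Additive.RestrictTowerCyclotomic
import HarnessLib

/-!
# The Route-G budget at LEVEL `n` from Tamagawa witnesses over `ℚ_n` (T-E3g-BUDn, FILE N2: assembly)

Cell `b2b-bsdres`, team n1011, seat p10 GEN 4, row **T-E3g-BUDn** (ROUTE-2 II.17, Option B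
"restrict the tower"; sequel of T-E3g-BUD0).

For the cyclotomic `ℤ_p`-extension `κ` of `ℚ` and a level `n`, let `K' = ℚ_n = κ.layer n` and let
`κ' : Γ_{ℚ_n} ↠ ℤ_p` be the RESTRICTED tower (`p^n · κ'(σ) = κ(σ|_ℚ)`; row T-E3g-BUDn-K supplies it
together with an injective transport `Sel_{p^∞}(E/ℚ_{n,∞}) ↪ Sel_{p^∞}(E/ℚ_∞)` — here both are
HYPOTHESES `hres`, stated literally as in `cells/n1011/route2/g11/BUDnSeamCheck.lean`).  Then
`κ'` is cyclotomic (`isCyclotomic_restrictTower`, seam (K2)), `E(ℚ_n)[p] = 0`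
(`forall_smul_eq_zero_baseChange_layer`, seam (S0)), and the K-general level-`0` socket
`exists_finset_layerZero_of_tamagawaWitnesses` over `ℚ_n` turns `#T₀` Tamagawa witnesses at places
`w ∤ p` of `ℚ_n` into `p^{#T₀}` classes of `A'_0[p]`, transported to `Sel_{p^∞}(E/ℚ_∞)[p]`
(`exists_finset_selmerInfty_torsion_of_layerZero`) and fed to the socket
`budgetLeLambdaAt_of_prop414_of_selmerInftyClasses`: **`BudgetLeLambdaAt p W b` for every `b` not
exceeding the witness count at level `n`** (`budgetLeLambdaAt_layer_of_tamagawaWitnesses`).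

The census (ROUTE-2 ST-17.5, EVIDENCE) reads the witness count at `n ≥ max_ℓ n_ℓ` as
`B(E,p) = Σ_ℓ s_ℓ` over the Tamagawa primes `ℓ` with `p ∣ c_ℓ` (`s_ℓ` = number of primes of `ℚ_∞`
above `ℓ`); the witnesses themselves come from rows T-BUD5-K (p16, split multiplicative) and
T-E3g-ADD (p06, additive) over `ℚ_n`, and the place count from T-E3g-BUDn-K (p01).

Binders (named facts / inputs, nothing asserted): Greenberg Prop. 4.14
(`prop414_noFiniteSubmodule_of_not_dvd_torsionOrder`), Poitou–Tate duality for Selmer structures over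
`ℚ_n`, the local Euler–Poincaré formula at the places of `ℚ_n`, the restricted tower + transport, the
witnesses; `p` odd, `p ∤ #E(ℚ)_tors`.

References: Greenberg, LNM 1716 (1999) §5 pp. 114–118 (proof of Cor. 5.6) and the example 406D1
(PCMI notes p. 184); K. Matsuno, Manuscripta Math. 122 (2007), Lemma 3.5, Remark and §4.  What is
new relative to these: additive reduction at `p` allowed, one inequality per layer, kernel form.
-/

set_option autoImplicit false

noncomputable section

open scoped Classical

open Function Field NumberField IsDedekindDomain WeierstrassCurve
open Literature.NumberTheory.EllipticCurves Literature.NumberTheory.GaloisRepresentations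
open Literature.NumberTheory.GaloisRepresentations.DiscreteGaloisModule (unramifiedSubgroup)
open Literature.NumberTheory.GaloisCohomology

namespace Summit.BirchSwinnertonDyer.Rank1Residual.Additive

/-! ### §1 `ℚ_n` is a number field -/

section Layer

variable {K : Type} [Field K] [NumberField K] {p : ℕ} [Fact p.Prime]

/-- The layer `K_n` of a `ℤ_p`-extension of a number field is a number field (finite over `K`:
`finiteDimensional_layer_holds`).  `NumberField` is a `Prop`-valued class and instance search does
not find this, so the statements below carry an instance binder `[NumberField (κ.layer n)]`
(discharged by this theorem via `haveI`; all such instances are definitionally equal). [folklore] -/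
theorem numberField_layer (κ : ZpExtension K p) (n : ℕ) : NumberField (κ.layer n) :=
  haveI : Module.Finite K (κ.layer n) := κ.finiteDimensional_layer_holds n
  NumberField.of_module_finite K _

end Layer

/-! ### §2 Classes of `Sel_{p^∞}(E/ℚ_∞)[p]` from witnesses over `ℚ_n` -/

section Classes

variable {W : WeierstrassCurve ℚ} [W.IsElliptic] {p : ℕ} [hp : Fact p.Prime]

/-- **`#T₀` Tamagawa witnesses over `ℚ_n` give `p^{#T₀}` classes of `Sel_{p^∞}(E/ℚ_∞)[p]`** for the
cyclotomic `κ`, given the restricted tower `κ'` over `ℚ_n` with an injective transport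
`Sel_{p^∞}(E/ℚ_{n,∞}) ↪ Sel_{p^∞}(E/ℚ_∞)`, a Poitou–Tate family over `ℚ_n`, the local
Euler–Poincaré formula, `p` odd and `p ∤ #E(ℚ)_tors`. [cite: GreenbergLNM1716, §5 pp. 114–118] -/
theorem exists_finset_selmerInfty_torsion_of_tamagawaWitnesses_layer (hodd : p ≠ 2)
    (htors : ¬ p ∣ W.torsionOrder) (κ : ZpExtension ℚ p) (hκ : κ.IsCyclotomic) (n : ℕ)
    [NumberField (κ.layer n)] (κ' : ZpExtension (κ.layer n) p)
    (hκ' : ∀ σ : absoluteGaloisGroup (κ.layer n),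
      (κ' σ).toAdd * (p : ℤ_[p]) ^ n = (κ (resGal (K := ℚ) (κ.layer n) σ)).toAdd)
    (f : (W.baseChange (κ.layer n)).selmerInfty κ' →+ W.selmerInfty κ) (hf : Injective f)
    (inv : LocalInvariants (κ.layer n) p) (hperf : inv.IsPerfect) (hsum : inv.SumLocalTermEqZero)
    (hcompl : inv.SelmerComplement)
    (hEP : ∀ w : HeightOneSpectrum (𝓞 (κ.layer n)),
      localEulerPoincareCharacteristic (w.adicCompletion (κ.layer n)))
    (T₀ : Finset (HeightOneSpectrum (𝓞 (κ.layer n))))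
    (hT₀p : ∀ w ∈ T₀, ((p : ℕ) : 𝓞 (κ.layer n)) ∉ w.asIdeal)
    (hwit : ∀ w ∈ T₀, ∃ u ∈ unramifiedSubgroup
        (((W.baseChange (κ.layer n)).torsionGaloisModule (p : ℤ)).restrictField
          (w.adicCompletion (κ.layer n))) 1,
      u ∉ (W.baseChange (κ.layer n)).kummerLocalConditionAt (p : ℤ) (w.adicCompletion (κ.layer n))) :
    ∃ t : Finset {y : W.selmerInfty κ // p • y = 0}, p ^ T₀.card ≤ t.card := by
  -- `E(ℚ_n)[p] = 0` (seam (S0)); the `DecidableEq` instances on the layer field differ between the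
  -- files (`Subtype` vs classical), `convert` identifies them at each use
  have hK' : ∀ Q : (W.baseChange (κ.layer n)).toAffine.Point, p • Q = 0 → Q = 0 :=
    forall_smul_eq_zero_baseChange_layer W p κ
      (fun P hP ↦ forall_smul_eq_zero_of_not_dvd_torsionOrder W p htors P (by convert hP)) n
  have hκ'c : κ'.IsCyclotomic := isCyclotomic_restrictTower κ hκ (κ.layer n) κ' n hκ'
  obtain ⟨s, hs⟩ := exists_finset_layerZero_of_tamagawaWitnesses (W.baseChange (κ.layer n)) p hodd
    (fun Q hQ ↦ hK' Q (by convert hQ)) inv hperf hsum hcompl hEP T₀ hT₀p hwit κ' hκ'c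
  obtain ⟨t, ht⟩ := exists_finset_selmerInfty_torsion_of_layerZero W p κ (W.baseChange (κ.layer n))
    κ' (fun Q hQ ↦ hK' Q (by convert hQ)) f hf s
  exact ⟨t, ht ▸ hs⟩

end Classes

/-! ### §3 The budget at level `n` -/

section Budget

variable {W : WeierstrassCurve ℚ} [W.IsElliptic] [W.IsGloballyMinimal] {p : ℕ} [hp : Fact p.Prime]

/-- **T-E3g-BUDn: the Route-G budget at level `n`.** Let `p` be an odd prime with
`p ∤ #E(ℚ)_tors` and `n : ℕ`.  Suppose that for every cyclotomic `κ` we are given, over the layer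
`ℚ_n = κ.layer n`: the restricted tower `κ'` with an injective transport
`Sel_{p^∞}(E/ℚ_{n,∞}) ↪ Sel_{p^∞}(E/ℚ_∞)` (row T-E3g-BUDn-K), a Poitou–Tate family and the local
Euler–Poincaré formula (named facts), and a finite set `T₀` of places `w ∤ p` of `ℚ_n` with
`b ≤ #T₀`, each carrying a Tamagawa witness (rows T-BUD5-K / T-E3g-ADD).  Then
`BudgetLeLambdaAt p W b`: `λ(X(E/ℚ_∞)) ≥ b` for every torsion Selmer-dual datum with `μ = 0`
(mod Greenberg Prop. 4.14).  Image-free; additive reduction at `p` allowed; one inequality per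
layer. [cite: GreenbergLNM1716, §5 pp. 114–118 and Prop. 4.14] -/
theorem budgetLeLambdaAt_layer_of_tamagawaWitnesses (hodd : p ≠ 2)
    (h414 : Greenberg1999.prop414_noFiniteSubmodule_of_not_dvd_torsionOrder)
    (htors : ¬ p ∣ W.torsionOrder) (n b : ℕ)
    (hres : ∀ (κ : ZpExtension ℚ p) [NumberField (κ.layer n)], κ.IsCyclotomic →
      ∃ κ' : ZpExtension (κ.layer n) p,
        (∀ σ : absoluteGaloisGroup (κ.layer n),
          (κ' σ).toAdd * (p : ℤ_[p]) ^ n = (κ (resGal (K := ℚ) (κ.layer n) σ)).toAdd) ∧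
        ∃ f : (W.baseChange (κ.layer n)).selmerInfty κ' →+ W.selmerInfty κ, Injective f)
    (hPT : ∀ (κ : ZpExtension ℚ p) [NumberField (κ.layer n)], κ.IsCyclotomic →
      poitouTate_selmerStructure_duality (κ.layer n))
    (hEP : ∀ (κ : ZpExtension ℚ p) [NumberField (κ.layer n)], κ.IsCyclotomic →
      ∀ w : HeightOneSpectrum (𝓞 (κ.layer n)),
      localEulerPoincareCharacteristic (w.adicCompletion (κ.layer n)))
    (hwitn : ∀ (κ : ZpExtension ℚ p) [NumberField (κ.layer n)], κ.IsCyclotomic →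
      ∃ T₀ : Finset (HeightOneSpectrum (𝓞 (κ.layer n))), b ≤ T₀.card ∧
        (∀ w ∈ T₀, ((p : ℕ) : 𝓞 (κ.layer n)) ∉ w.asIdeal) ∧
        ∀ w ∈ T₀, ∃ u ∈ unramifiedSubgroup
            (((W.baseChange (κ.layer n)).torsionGaloisModule (p : ℤ)).restrictField
              (w.adicCompletion (κ.layer n))) 1,
          u ∉ (W.baseChange (κ.layer n)).kummerLocalConditionAt (p : ℤ)
            (w.adicCompletion (κ.layer n))) :
    BudgetLeLambdaAt p W b := by
  refine budgetLeLambdaAt_of_prop414_of_selmerInftyClasses h414 htors fun κ hκ ↦ ?_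
  haveI : NeZero p := ⟨hp.out.ne_zero⟩
  haveI : NumberField (κ.layer n) := numberField_layer κ n
  obtain ⟨κ', hκ', f, hf⟩ := hres κ hκ
  obtain ⟨inv, hperf, hsum, -, hcompl⟩ := hPT κ hκ p
  obtain ⟨T₀, hb, hT₀p, hwit⟩ := hwitn κ hκ
  obtain ⟨t, ht⟩ := exists_finset_selmerInfty_torsion_of_tamagawaWitnesses_layer hodd htors κ hκ n
    κ' hκ' f hf inv hperf hsum hcompl (hEP κ hκ) T₀ hT₀p hwit
  exact ⟨t, (Nat.pow_le_pow_right hp.out.pos hb).trans ht⟩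

/-- **The residual count at level `n`** (same inputs, plus finiteness of `Sel_{p^∞}(E/ℚ_∞)[p]`):
`ResidualSelmerRankGeAt p W b`. [cite: GreenbergLNM1716, §5 pp. 114–118] -/
theorem residualSelmerRankGeAt_layer_of_tamagawaWitnesses (hodd : p ≠ 2)
    (htors : ¬ p ∣ W.torsionOrder) (n b : ℕ)
    (hfin : ∀ (κ : ZpExtension ℚ p), κ.IsCyclotomic → Finite {s : W.selmerInfty κ // p • s = 0})
    (hres : ∀ (κ : ZpExtension ℚ p) [NumberField (κ.layer n)], κ.IsCyclotomic →
      ∃ κ' : ZpExtension (κ.layer n) p,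
        (∀ σ : absoluteGaloisGroup (κ.layer n),
          (κ' σ).toAdd * (p : ℤ_[p]) ^ n = (κ (resGal (K := ℚ) (κ.layer n) σ)).toAdd) ∧
        ∃ f : (W.baseChange (κ.layer n)).selmerInfty κ' →+ W.selmerInfty κ, Injective f)
    (hPT : ∀ (κ : ZpExtension ℚ p) [NumberField (κ.layer n)], κ.IsCyclotomic →
      poitouTate_selmerStructure_duality (κ.layer n))
    (hEP : ∀ (κ : ZpExtension ℚ p) [NumberField (κ.layer n)], κ.IsCyclotomic →
      ∀ w : HeightOneSpectrum (𝓞 (κ.layer n)),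
      localEulerPoincareCharacteristic (w.adicCompletion (κ.layer n)))
    (hwitn : ∀ (κ : ZpExtension ℚ p) [NumberField (κ.layer n)], κ.IsCyclotomic →
      ∃ T₀ : Finset (HeightOneSpectrum (𝓞 (κ.layer n))), b ≤ T₀.card ∧
        (∀ w ∈ T₀, ((p : ℕ) : 𝓞 (κ.layer n)) ∉ w.asIdeal) ∧
        ∀ w ∈ T₀, ∃ u ∈ unramifiedSubgroup
            (((W.baseChange (κ.layer n)).torsionGaloisModule (p : ℤ)).restrictField
              (w.adicCompletion (κ.layer n))) 1,
          u ∉ (W.baseChange (κ.layer n)).kummerLocalConditionAt (p : ℤ)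
            (w.adicCompletion (κ.layer n))) :
    ResidualSelmerRankGeAt p W b := by
  refine residualSelmerRankGeAt_of_selmerInftyClasses hfin fun κ hκ ↦ ?_
  haveI : NeZero p := ⟨hp.out.ne_zero⟩
  haveI : NumberField (κ.layer n) := numberField_layer κ n
  obtain ⟨κ', hκ', f, hf⟩ := hres κ hκ
  obtain ⟨inv, hperf, hsum, -, hcompl⟩ := hPT κ hκ p
  obtain ⟨T₀, hb, hT₀p, hwit⟩ := hwitn κ hκ
  obtain ⟨t, ht⟩ := exists_finset_selmerInfty_torsion_of_tamagawaWitnesses_layer hodd htors κ hκ n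
    κ' hκ' f hf inv hperf hsum hcompl (hEP κ hκ) T₀ hT₀p hwit
  exact ⟨t, (Nat.pow_le_pow_right hp.out.pos hb).trans ht⟩

end Budget

end Summit.BirchSwinnertonDyer.Rank1Residual.Additive
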